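import Literature.MathematicalPhysics.QuantumFieldTheory.CurvatureGaussianField
import Literature.Barriers.CriticalPhenomena.RigorousRGSmallParameterGaussianIBP
import HarnessLib

/-!
# Fourth moments of the curvature Gaussian field: the covariance of two plaquette energies

Support file for the statement item `stmt-QuantumFields-12314`
(`Summit.QuantumFields.YangMills.Theses.DirichletWindow.LocalGaussianity`), line «exp-moment tangent law», stub
`stub_secondOrderLocalLaw` (the Gaussian side of the second-order local free-gluon law).  Route-independent content:

* `GaussMoments.integral_pow_four_gaussianReal` — `∫ x⁴ dN(0, v) = 3v²` (Stein's lemma of the tree's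
  `GaussIBP.stein` twice at `v = 1`, then scaling), and `integral_pow_four_of_hasGaussianLaw` — `E Z⁴ = 3 (Var Z)²` for a
  centred real Gaussian random variable;
* `GaussMoments.integral_sq_mul_sq` — under `ν = curvatureGaussianField 4 D`:
  `E[(Y_p^a)² (Y_q^b)²] = 1/4 + 2 (δ_{ab} c_{pq})²`, `c_{pq} = curvatureTwoPoint p q` (Isserlis / Wick for the pair, by
  POLARISATION: `(U+V)⁴ + (U−V)⁴ = 2U⁴ + 12U²V² + 2V⁴` with `U ± V` Gaussian of variance `1 ± 2K`,
  `K = Cov(U,V)`; the covariance structure is the tree's `covariance_eval_curvatureGaussianField`,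
  `isGaussianProcess_eval_curvatureGaussianField`);
* `GaussMoments.cov_energy` — for the plaquette energies `Q_p = ½ Σ_a (Y_p^a)²`:
  `E[Q_p Q_q] − E[Q_p] E[Q_q] = (D/2) c_{pq}²`, together with the integrability of `Q_p`, `Q_p Q_q` and
  `E[Q_p] = D/4`;
* `GaussMoments.tendsto_truncated_cov` — the truncated covariances `Cov(Q_p ∧ M, Q_q ∧ M)` converge to
  `(D/2) c_{pq}²` as `M → ∞` (dominated convergence).

Elementary Gaussian calculus ([folklore]); no rung or summit statement is proved here.
-/

noncomputable section

open MeasureTheory ProbabilityTheory Filter Topology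
open scoped NNReal ENNReal
open Literature.MathematicalPhysics.QuantumFieldTheory Literature.MathematicalPhysics.QuantumLattice

namespace Summit.QuantumFields.YangMills.Theorems.LocalGaussianityExpMomentTangentLaw

namespace GaussMoments

/-! ### Fourth moments of real Gaussians -/

/-- `∫ x² dN(0,1) = 1` and `∫ x⁴ dN(0,1) = 3` (Stein's lemma). -/
theorem integral_pow_four_gaussianReal_zero_one :
    ∫ x, x ^ 2 ∂(gaussianReal 0 1) = 1 ∧ ∫ x, x ^ 4 ∂(gaussianReal 0 1) = 3 := by
  have h2 : ∫ x, x ^ 2 ∂(gaussianReal 0 1) = 1 := by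
    have hs := Literature.Barriers.CriticalPhenomena.LongRangePhi4.GaussIBP.stein
      (g := fun x => x) (g' := fun _ => (1 : ℝ)) (fun x => hasDerivAt_id x) continuous_const
      (B := 1) (p := 1) (fun x => by simp) (fun x => by simp [abs_nonneg x])
    simp only [integral_const, probReal_univ, smul_eq_mul, mul_one] at hs
    rw [← hs]
    congr 1
    funext x
    ring
  refine ⟨h2, ?_⟩
  have hs := Literature.Barriers.CriticalPhenomena.LongRangePhi4.GaussIBP.stein
    (g := fun x => x ^ 3) (g' := fun x => 3 * x ^ 2) (fun x => by simpa using hasDerivAt_pow 3 x)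
    (by fun_prop) (B := 3) (p := 3) (fun x => ?_) (fun x => ?_)
  · have h4 : ∫ x, x ^ 4 ∂(gaussianReal 0 1) = ∫ x, x * x ^ 3 ∂(gaussianReal 0 1) := by
      congr 1
      funext x
      ring
    rw [h4, hs, integral_const_mul, h2]
    norm_num
  · rw [abs_pow]
    have h1 : |x| ^ 3 ≤ (1 + |x|) ^ 3 := pow_le_pow_left₀ (abs_nonneg x) (by linarith [abs_nonneg x]) 3
    nlinarith [pow_nonneg (by positivity : (0:ℝ) ≤ 1 + |x|) 3]
  · rw [abs_mul, abs_pow, abs_of_pos (by norm_num : (0:ℝ) < 3)]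
    refine mul_le_mul_of_nonneg_left ?_ (by norm_num)
    calc |x| ^ 2 ≤ (1 + |x|) ^ 2 := pow_le_pow_left₀ (abs_nonneg x) (by linarith [abs_nonneg x]) 2
      _ ≤ (1 + |x|) ^ 3 := pow_le_pow_right₀ (by linarith [abs_nonneg x]) (by norm_num)

/-- `∫ x⁴ dN(0,v) = 3v²` (scaling `x ↦ √v x` of the standard Gaussian). -/
theorem integral_pow_four_gaussianReal (v : ℝ≥0) :
    ∫ x, x ^ 4 ∂(gaussianReal 0 v) = 3 * (v : ℝ) ^ 2 := by
  have hv : gaussianReal 0 v = (gaussianReal 0 1).map (fun x => Real.sqrt v * x) := by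
    rw [gaussianReal_map_const_mul]
    congr 1
    · simp
    · ext
      simp [Real.sq_sqrt v.coe_nonneg]
  rw [hv, integral_map (by fun_prop) (by fun_prop)]
  simp only [mul_pow]
  rw [integral_const_mul, integral_pow_four_gaussianReal_zero_one.2]
  have : Real.sqrt v ^ 4 = (v : ℝ) ^ 2 := by
    rw [show (4 : ℕ) = 2 * 2 from rfl, pow_mul, Real.sq_sqrt v.coe_nonneg]
  rw [this]
  ring

/-- **`E Z⁴ = 3 (Var Z)²` for a centred real Gaussian random variable.** -/
theorem integral_pow_four_of_hasGaussianLaw {Ω : Type*} [MeasurableSpace Ω] {P : Measure Ω} {Z : Ω → ℝ}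
    (hZ : HasGaussianLaw Z P) (h0 : P[Z] = 0) : ∫ ω, Z ω ^ 4 ∂P = 3 * Var[Z; P] ^ 2 := by
  have hmap := hZ.map_eq_gaussianReal
  rw [h0] at hmap
  have : ∫ ω, Z ω ^ 4 ∂P = ∫ x, x ^ 4 ∂(P.map Z) := by
    rw [integral_map hZ.aemeasurable (by fun_prop)]
  rw [this, hmap, integral_pow_four_gaussianReal, Real.coe_toNNReal _ (variance_nonneg Z P)]

/-- A real Gaussian random variable has an integrable fourth power. -/
theorem integrable_pow_four_of_hasGaussianLaw {Ω : Type*} [MeasurableSpace Ω] {P : Measure Ω} {Z : Ω → ℝ}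
    (hZ : HasGaussianLaw Z P) : Integrable (fun ω => Z ω ^ 4) P := by
  have hm : MemLp Z ((4 : ℕ) : ℝ≥0∞) P := hZ.memLp (by simp)
  refine (hm.integrable_norm_pow (by norm_num)).congr (ae_of_all _ fun ω => ?_)
  simp only [Real.norm_eq_abs]
  exact (show Even 4 by decide).pow_abs (Z ω)

/-! ### The curvature Gaussian field: pair fourth moments by polarisation -/

section Field

variable (D : ℕ)

/-- The curvature Gaussian field of `ℤ⁴` is a probability measure. -/
theorem isProbabilityMeasure_field : IsProbabilityMeasure (curvatureGaussianField 4 D) :=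
  isProbabilityMeasure_curvatureGaussianField (by norm_num) D

/-- The coordinates `Y ↦ Y_p^a` have Gaussian law. -/
theorem hasGaussianLaw_eval (p : ZdPlaquette 4) (a : Fin D) :
    HasGaussianLaw (fun Y : ZdPlaquette 4 → Fin D → ℝ => Y p a) (curvatureGaussianField 4 D) :=
  (isGaussianProcess_eval_curvatureGaussianField (by norm_num : 3 ≤ 4) D).hasGaussianLaw_eval (p, a)

/-- Measurability of the coordinate maps `Y ↦ Y_p^a`. -/
theorem measurable_eval (p : ZdPlaquette 4) (a : Fin D) :
    Measurable (fun Y : ZdPlaquette 4 → Fin D → ℝ => Y p a) :=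
  (measurable_pi_apply a).comp (measurable_pi_apply p)

/-- A coordinate is integrable to any natural power (`Y ↦ (Y_p^a)^k`): Gaussians have all moments. -/
theorem integrable_eval_pow (p : ZdPlaquette 4) (a : Fin D) (k : ℕ) :
    Integrable (fun Y : ZdPlaquette 4 → Fin D → ℝ => (Y p a) ^ k) (curvatureGaussianField 4 D) := by
  haveI := isProbabilityMeasure_field D
  rcases Nat.eq_zero_or_pos k with hk | hk
  · subst hk
    simp only [pow_zero]
    exact integrable_const _
  have h := ((hasGaussianLaw_eval D p a).memLp (p := (k : ℝ≥0∞)) (by simp)).integrable_norm_pow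
    (Nat.pos_iff_ne_zero.1 hk)
  exact h.mono' ((measurable_eval D p a).pow_const k).aestronglyMeasurable
    (ae_of_all _ fun Y => by rw [norm_pow])

/-- The product `(Y_p^a)² (Y_q^b)²` is integrable (`2uv ≤ u² + v²`). -/
theorem integrable_sq_mul_sq (p q : ZdPlaquette 4) (a b : Fin D) :
    Integrable (fun Y : ZdPlaquette 4 → Fin D → ℝ => (Y p a) ^ 2 * (Y q b) ^ 2)
      (curvatureGaussianField 4 D) := by
  refine ((integrable_eval_pow D p a 4).add (integrable_eval_pow D q b 4)).mono'
    (((measurable_eval D p a).pow_const 2).mul ((measurable_eval D q b).pow_const 2)).aestronglyMeasurable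
    (ae_of_all _ fun Y => ?_)
  rw [Real.norm_eq_abs, abs_of_nonneg (by positivity), Pi.add_apply]
  nlinarith [sq_nonneg ((Y p a) ^ 2 - (Y q b) ^ 2), sq_nonneg ((Y p a) ^ 2), sq_nonneg ((Y q b) ^ 2)]

/-- The coordinates are centred. -/
theorem integral_eval (p : ZdPlaquette 4) (a : Fin D) :
    ∫ Y, Y p a ∂(curvatureGaussianField 4 D) = 0 :=
  integral_eval_curvatureGaussianField (by norm_num : 3 ≤ 4) D p a

/-- Second moments: `E[(Y_p^a)²] = 1/2` (`d = 4`). -/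
theorem integral_sq (p : ZdPlaquette 4) (a : Fin D) :
    ∫ Y, (Y p a) ^ 2 ∂(curvatureGaussianField 4 D) = 1 / 2 := by
  haveI := isProbabilityMeasure_field D
  have hv := variance_eval_curvatureGaussianField (by norm_num : 3 ≤ 4) D p a
  rw [variance_eq_sub ((hasGaussianLaw_eval D p a).memLp_two), integral_eval] at hv
  simp only [ne_eq, OfNat.ofNat_ne_zero, not_false_eq_true, zero_pow, sub_zero] at hv
  have : (fun Y : ZdPlaquette 4 → Fin D → ℝ => (Y p a) ^ 2) =
      (fun Y : ZdPlaquette 4 → Fin D → ℝ => Y p a) ^ 2 := by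
    funext Y; simp
  rw [this, hv]
  norm_num

/-- **Pair fourth moments of the curvature Gaussian field** (Isserlis for one pair, by polarisation):
`E[(Y_p^a)² (Y_q^b)²] = 1/4 + 2 (δ_{ab} c_{pq})²`, `c_{pq} = curvatureTwoPoint p q`. -/
theorem integral_sq_mul_sq (p q : ZdPlaquette 4) (a b : Fin D) :
    ∫ Y, (Y p a) ^ 2 * (Y q b) ^ 2 ∂(curvatureGaussianField 4 D) =
      1 / 4 + 2 * (if a = b then curvatureTwoPoint p q else 0) ^ 2 := by
  haveI := isProbabilityMeasure_field D
  set ν := curvatureGaussianField 4 D with hν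
  set K : ℝ := if a = b then curvatureTwoPoint p q else 0 with hK
  have hGP := isGaussianProcess_eval_curvatureGaussianField (by norm_num : 3 ≤ 4) D
  set U : (ZdPlaquette 4 → Fin D → ℝ) → ℝ := fun Y => Y p a with hU
  set V : (ZdPlaquette 4 → Fin D → ℝ) → ℝ := fun Y => Y q b with hV
  have hUg : HasGaussianLaw U ν := hasGaussianLaw_eval D p a
  have hVg : HasGaussianLaw V ν := hasGaussianLaw_eval D q b
  have hSg : HasGaussianLaw (U + V) ν := hGP.hasGaussianLaw_add (s := (p, a)) (t := (q, b))
  have hTg : HasGaussianLaw (U - V) ν := hGP.hasGaussianLaw_sub (s := (p, a)) (t := (q, b))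
  have hU2 : MemLp U 2 ν := hUg.memLp_two
  have hV2 : MemLp V 2 ν := hVg.memLp_two
  -- means
  have hU0 : ν[U] = 0 := integral_eval D p a
  have hV0 : ν[V] = 0 := integral_eval D q b
  have hS0 : ν[U + V] = 0 := by
    rw [integral_add' hUg.integrable hVg.integrable, hU0, hV0, add_zero]
  have hT0 : ν[U - V] = 0 := by
    rw [integral_sub' hUg.integrable hVg.integrable, hU0, hV0, sub_zero]
  -- variances
  have hcov : cov[U, V; ν] = K := covariance_eval_curvatureGaussianField (by norm_num : 3 ≤ 4) D p q a b
  have hUvar : Var[U; ν] = 1 / 2 := by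
    rw [hU, variance_eval_curvatureGaussianField (by norm_num : 3 ≤ 4) D p a]; norm_num
  have hVvar : Var[V; ν] = 1 / 2 := by
    rw [hV, variance_eval_curvatureGaussianField (by norm_num : 3 ≤ 4) D q b]; norm_num
  have hSvar : Var[U + V; ν] = 1 + 2 * K := by
    rw [variance_add hU2 hV2, hUvar, hVvar, hcov]; ring
  have hTvar : Var[U - V; ν] = 1 - 2 * K := by
    rw [variance_sub hU2 hV2, hUvar, hVvar, hcov]; ring
  -- fourth moments
  have hU4 : ∫ Y, U Y ^ 4 ∂ν = 3 / 4 := by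
    rw [integral_pow_four_of_hasGaussianLaw hUg hU0, hUvar]; norm_num
  have hV4 : ∫ Y, V Y ^ 4 ∂ν = 3 / 4 := by
    rw [integral_pow_four_of_hasGaussianLaw hVg hV0, hVvar]; norm_num
  have hS4 : ∫ Y, (U + V) Y ^ 4 ∂ν = 3 * (1 + 2 * K) ^ 2 := by
    rw [integral_pow_four_of_hasGaussianLaw hSg hS0, hSvar]
  have hT4 : ∫ Y, (U - V) Y ^ 4 ∂ν = 3 * (1 - 2 * K) ^ 2 := by
    rw [integral_pow_four_of_hasGaussianLaw hTg hT0, hTvar]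
  -- integrability
  have hU4i : Integrable (fun Y => U Y ^ 4) ν := integrable_eval_pow D p a 4
  have hV4i : Integrable (fun Y => V Y ^ 4) ν := integrable_eval_pow D q b 4
  have hUVi : Integrable (fun Y => U Y ^ 2 * V Y ^ 2) ν := integrable_sq_mul_sq D p q a b
  have hS4i : Integrable (fun Y => (U + V) Y ^ 4) ν := integrable_pow_four_of_hasGaussianLaw hSg
  have hT4i : Integrable (fun Y => (U - V) Y ^ 4) ν := integrable_pow_four_of_hasGaussianLaw hTg
  -- polarisation: `(U+V)⁴ + (U−V)⁴ = 2U⁴ + 12 U²V² + 2V⁴`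
  have hpt : ∀ Y, (U + V) Y ^ 4 + (U - V) Y ^ 4 = 2 * U Y ^ 4 + 12 * (U Y ^ 2 * V Y ^ 2) + 2 * V Y ^ 4 := by
    intro Y
    simp only [Pi.add_apply, Pi.sub_apply]
    ring
  have hpol : ∫ Y, (U + V) Y ^ 4 ∂ν + ∫ Y, (U - V) Y ^ 4 ∂ν =
      2 * ∫ Y, U Y ^ 4 ∂ν + 12 * ∫ Y, U Y ^ 2 * V Y ^ 2 ∂ν + 2 * ∫ Y, V Y ^ 4 ∂ν := by
    rw [← integral_add hS4i hT4i]
    simp_rw [hpt]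
    have h1 : Integrable (fun Y => 2 * U Y ^ 4) ν := hU4i.const_mul 2
    have h2 : Integrable (fun Y => 12 * (U Y ^ 2 * V Y ^ 2)) ν := hUVi.const_mul 12
    have h3 : Integrable (fun Y => 2 * V Y ^ 4) ν := hV4i.const_mul 2
    have h12 : Integrable (fun Y => 2 * U Y ^ 4 + 12 * (U Y ^ 2 * V Y ^ 2)) ν := h1.add h2
    rw [integral_add h12 h3, integral_add h1 h2, integral_const_mul, integral_const_mul,
      integral_const_mul]
  rw [hS4, hT4, hU4, hV4] at hpol
  have : ∫ Y, U Y ^ 2 * V Y ^ 2 ∂ν = 1 / 4 + 2 * K ^ 2 := by linarith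
  simpa only [hU, hV] using this

/-! ### Plaquette energies `Q_p = ½ Σ_a (Y_p^a)²` -/

/-- `E[Q_p] = D/4`. -/
theorem integral_energy (p : ZdPlaquette 4) :
    ∫ Y, (1 / 2 : ℝ) * ∑ a : Fin D, (Y p a) ^ 2 ∂(curvatureGaussianField 4 D) = (D : ℝ) / 4 := by
  rw [integral_const_mul, integral_finsetSum _ fun a _ => integrable_eval_pow D p a 2]
  simp only [integral_sq, Finset.sum_const, Finset.card_univ, Fintype.card_fin, nsmul_eq_mul]
  ring

/-- `Q_p` is integrable. -/
theorem integrable_energy (p : ZdPlaquette 4) :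
    Integrable (fun Y : ZdPlaquette 4 → Fin D → ℝ => (1 / 2 : ℝ) * ∑ a : Fin D, (Y p a) ^ 2)
      (curvatureGaussianField 4 D) :=
  (integrable_finsetSum _ fun a _ => integrable_eval_pow D p a 2).const_mul _

/-- `Q_p Q_q` is integrable. -/
theorem integrable_energy_mul (p q : ZdPlaquette 4) :
    Integrable (fun Y : ZdPlaquette 4 → Fin D → ℝ =>
      ((1 / 2 : ℝ) * ∑ a : Fin D, (Y p a) ^ 2) * ((1 / 2 : ℝ) * ∑ b : Fin D, (Y q b) ^ 2))
      (curvatureGaussianField 4 D) := by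
  have h : Integrable (fun Y : ZdPlaquette 4 → Fin D → ℝ =>
      (1 / 4 : ℝ) * ∑ a : Fin D, ∑ b : Fin D, (Y p a) ^ 2 * (Y q b) ^ 2) (curvatureGaussianField 4 D) :=
    (integrable_finsetSum _ fun a _ => integrable_finsetSum _ fun b _ =>
      integrable_sq_mul_sq D p q a b).const_mul _
  refine h.congr (ae_of_all _ fun Y => ?_)
  simp only
  rw [← Finset.sum_mul_sum]
  ring

/-- **The covariance of two plaquette energies under the curvature Gaussian field**:
`E[Q_p Q_q] − E[Q_p] E[Q_q] = (D/2) · c_{pq}²`. -/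
theorem cov_energy (p q : ZdPlaquette 4) :
    (∫ Y, ((1 / 2 : ℝ) * ∑ a : Fin D, (Y p a) ^ 2) * ((1 / 2 : ℝ) * ∑ b : Fin D, (Y q b) ^ 2)
        ∂(curvatureGaussianField 4 D)) -
      (∫ Y, (1 / 2 : ℝ) * ∑ a : Fin D, (Y p a) ^ 2 ∂(curvatureGaussianField 4 D)) *
        (∫ Y, (1 / 2 : ℝ) * ∑ b : Fin D, (Y q b) ^ 2 ∂(curvatureGaussianField 4 D)) =
      (D : ℝ) / 2 * curvatureTwoPoint p q ^ 2 := by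
  rw [integral_energy, integral_energy]
  have hpt : ∀ Y : ZdPlaquette 4 → Fin D → ℝ,
      ((1 / 2 : ℝ) * ∑ a : Fin D, (Y p a) ^ 2) * ((1 / 2 : ℝ) * ∑ b : Fin D, (Y q b) ^ 2) =
        (1 / 4 : ℝ) * ∑ a : Fin D, ∑ b : Fin D, (Y p a) ^ 2 * (Y q b) ^ 2 := by
    intro Y
    rw [← Finset.sum_mul_sum]
    ring
  have h : ∫ Y, ((1 / 2 : ℝ) * ∑ a : Fin D, (Y p a) ^ 2) * ((1 / 2 : ℝ) * ∑ b : Fin D, (Y q b) ^ 2)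
        ∂(curvatureGaussianField 4 D) =
      (1 / 4 : ℝ) * ∑ a : Fin D, ∑ b : Fin D,
        ∫ Y, (Y p a) ^ 2 * (Y q b) ^ 2 ∂(curvatureGaussianField 4 D) := by
    simp_rw [hpt]
    rw [integral_const_mul, integral_finsetSum _ fun a _ =>
      integrable_finsetSum _ fun b _ => integrable_sq_mul_sq D p q a b]
    congr 1
    refine Finset.sum_congr rfl fun a _ => ?_
    rw [integral_finsetSum _ fun b _ => integrable_sq_mul_sq D p q a b]
  rw [h]
  simp_rw [integral_sq_mul_sq]
  have hite : ∀ a b : Fin D, (1 / 4 : ℝ) + 2 * (if a = b then curvatureTwoPoint p q else 0) ^ 2 =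
      1 / 4 + (if a = b then 2 * curvatureTwoPoint p q ^ 2 else 0) := by
    intro a b
    split_ifs <;> ring
  simp_rw [hite, Finset.sum_add_distrib, Finset.sum_ite_eq, Finset.mem_univ, if_true, Finset.sum_const,
    Finset.card_univ, Fintype.card_fin, nsmul_eq_mul]
  ring

/-! ### Truncation `t ↦ (t⁺) ∧ M` and the truncated covariances -/

omit D in
/-- The clamp `min (max t 0) M` is the identity on `[0, M]`. -/
theorem clamp_eq {t M : ℝ} (h0 : 0 ≤ t) (hM : t ≤ M) : min (max t 0) M = t := by
  rw [max_eq_left h0, min_eq_left hM]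

omit D in
/-- The clamp is non-negative. -/
theorem clamp_nonneg (t M : ℝ) (hM : 0 ≤ M) : 0 ≤ min (max t 0) M :=
  le_min (le_max_right _ _) hM

omit D in
/-- The clamp is at most `t` for `t ≥ 0`. -/
theorem clamp_le_self {t : ℝ} (M : ℝ) (h0 : 0 ≤ t) : min (max t 0) M ≤ t := by
  rw [max_eq_left h0]
  exact min_le_left _ _

omit D in
/-- The clamp is bounded by `M` in absolute value (`M ≥ 0`). -/
theorem abs_clamp_le (t : ℝ) {M : ℝ} (hM : 0 ≤ M) : |min (max t 0) M| ≤ M := by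
  rw [abs_of_nonneg (clamp_nonneg t M hM)]
  exact min_le_right _ _

omit D in
/-- The clamp is continuous in `t`. -/
theorem continuous_clamp (M : ℝ) : Continuous fun t : ℝ => min (max t 0) M := by
  fun_prop

/-- Measurability of the plaquette energy `Q_p`. -/
theorem measurable_energy (p : ZdPlaquette 4) :
    Measurable (fun Y : ZdPlaquette 4 → Fin D → ℝ => (1 / 2 : ℝ) * ∑ a : Fin D, (Y p a) ^ 2) :=
  (Finset.measurable_sum _ fun a _ => (measurable_eval D p a).pow_const 2).const_mul _

omit D in
/-- Pointwise, the clamped value is eventually (in `M → ∞` along `ℕ`) the value itself (`t ≥ 0`). -/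
theorem eventually_clamp_eq {t : ℝ} (h0 : 0 ≤ t) : ∀ᶠ M : ℕ in atTop, min (max t 0) (M : ℝ) = t := by
  filter_upwards [eventually_ge_atTop ⌈t⌉₊] with M hM
  exact clamp_eq h0 ((Nat.le_ceil t).trans (by exact_mod_cast hM))

/-- **The truncated covariances of two plaquette energies converge to `(D/2) c_{pq}²`** as the truncation
level `M → ∞` (dominated convergence; the limit is `cov_energy`). -/
theorem tendsto_truncated_cov (p q : ZdPlaquette 4) :
    Tendsto (fun M : ℕ =>
      (∫ Y, min (max ((1 / 2 : ℝ) * ∑ a : Fin D, (Y p a) ^ 2) 0) (M : ℝ) *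
          min (max ((1 / 2 : ℝ) * ∑ b : Fin D, (Y q b) ^ 2) 0) (M : ℝ) ∂(curvatureGaussianField 4 D)) -
        (∫ Y, min (max ((1 / 2 : ℝ) * ∑ a : Fin D, (Y p a) ^ 2) 0) (M : ℝ) ∂(curvatureGaussianField 4 D)) *
          (∫ Y, min (max ((1 / 2 : ℝ) * ∑ b : Fin D, (Y q b) ^ 2) 0) (M : ℝ) ∂(curvatureGaussianField 4 D)))
      atTop (𝓝 ((D : ℝ) / 2 * curvatureTwoPoint p q ^ 2)) := by
  set ν := curvatureGaussianField 4 D with hν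
  set Qp : (ZdPlaquette 4 → Fin D → ℝ) → ℝ := fun Y => (1 / 2 : ℝ) * ∑ a : Fin D, (Y p a) ^ 2 with hQp
  set Qq : (ZdPlaquette 4 → Fin D → ℝ) → ℝ := fun Y => (1 / 2 : ℝ) * ∑ b : Fin D, (Y q b) ^ 2 with hQq
  have hQp0 : ∀ Y, 0 ≤ Qp Y := fun Y => by positivity
  have hQq0 : ∀ Y, 0 ≤ Qq Y := fun Y => by positivity
  have hmp : Measurable Qp := measurable_energy D p
  have hmq : Measurable Qq := measurable_energy D q
  rw [← cov_energy D p q]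
  -- the three dominated-convergence limits
  have T1 : Tendsto (fun M : ℕ => ∫ Y, min (max (Qp Y) 0) (M : ℝ) * min (max (Qq Y) 0) (M : ℝ) ∂ν) atTop
      (𝓝 (∫ Y, Qp Y * Qq Y ∂ν)) := by
    refine tendsto_integral_of_dominated_convergence (fun Y => Qp Y * Qq Y) (fun M => ?_)
      (integrable_energy_mul D p q) (fun M => ae_of_all _ fun Y => ?_) (ae_of_all _ fun Y => ?_)
    · exact (((continuous_clamp (M : ℝ)).measurable.comp hmp).mul
        ((continuous_clamp (M : ℝ)).measurable.comp hmq)).aestronglyMeasurable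
    · rw [Real.norm_eq_abs, abs_of_nonneg (mul_nonneg (clamp_nonneg _ _ (Nat.cast_nonneg M))
        (clamp_nonneg _ _ (Nat.cast_nonneg M)))]
      exact mul_le_mul (clamp_le_self _ (hQp0 Y)) (clamp_le_self _ (hQq0 Y))
        (clamp_nonneg _ _ (Nat.cast_nonneg M)) (hQp0 Y)
    · refine tendsto_const_nhds.congr' ?_
      filter_upwards [eventually_clamp_eq (hQp0 Y), eventually_clamp_eq (hQq0 Y)] with M h1 h2
      rw [h1, h2]
  have T2 : ∀ (r : ZdPlaquette 4), Tendsto (fun M : ℕ =>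
      ∫ Y, min (max ((1 / 2 : ℝ) * ∑ a : Fin D, (Y r a) ^ 2) 0) (M : ℝ) ∂ν) atTop
      (𝓝 (∫ Y, (1 / 2 : ℝ) * ∑ a : Fin D, (Y r a) ^ 2 ∂ν)) := by
    intro r
    have h0 : ∀ Y : ZdPlaquette 4 → Fin D → ℝ, 0 ≤ (1 / 2 : ℝ) * ∑ a : Fin D, (Y r a) ^ 2 :=
      fun Y => by positivity
    refine tendsto_integral_of_dominated_convergence (fun Y => (1 / 2 : ℝ) * ∑ a : Fin D, (Y r a) ^ 2)
      (fun M => ?_) (integrable_energy D r) (fun M => ae_of_all _ fun Y => ?_) (ae_of_all _ fun Y => ?_)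
    · exact ((continuous_clamp (M : ℝ)).measurable.comp (measurable_energy D r)).aestronglyMeasurable
    · rw [Real.norm_eq_abs, abs_of_nonneg (clamp_nonneg _ _ (Nat.cast_nonneg M))]
      exact clamp_le_self _ (h0 Y)
    · refine tendsto_const_nhds.congr' ?_
      filter_upwards [eventually_clamp_eq (h0 Y)] with M h1
      rw [h1]
  exact T1.sub ((T2 p).mul (T2 q))

end Field

end GaussMoments

end Summit.QuantumFields.YangMills.Theorems.LocalGaussianityExpMomentTangentLaw

end
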